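import Mathlib
import Literature.MathematicalPhysics.KineticTheory.HardSphereEulerPrimitiveForm
import Literature.MathematicalPhysics.KineticTheory.HardSphereEulerLocalTheoryProofs
import Literature.Analysis.FunctionSpaces.TorusCalculusProofs
import Literature.Analysis.FunctionSpaces.TorusSpaceTime
import HarnessLib

/-!
# `EntropicWeakStrongHS` (stmt-AtomisticToContinuum-13461), calculus I: derivatives of the
# entropy variables along a classical hard-sphere Euler solution

For a classical solution `(ρ, u, θ)` of the hard-sphere Euler system on `[0, T) × 𝕋³` under the
low-density equation of state (`hsExcessFreeEnergy = F` on `[0, η₀)`, `F` analytic, packing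
`ρσ³ < η₀`), the entropy-variable field
`λ = (-(3/2 log θ - log ρ - f(ρσ³)) + 5/2 - |u|²/(2θ) + ρσ³ f'(ρσ³), u/θ, -1/θ)` (`= Dh(U)`,
`h = -ρ s` the convex entropy in conservative variables) is differentiated along time slices
(one-sided, within `[0, T)`) and along coordinate lines, by the chain rule:
`∂λ¹ = (γ/ρ) ∂ρ - (u·∂u)/θ + (|u|²/(2θ²) - 3/(2θ)) ∂θ`, `∂λᵐ = ∂u/θ - (∂θ/θ²) u`,
`∂λᴱ = ∂θ/θ²`, where `γ = 1 + 2ηF'(η) + η²F''(η)`, `η = ρσ³`.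

* `hasDerivWithinAt_entropyVar` — the generic chain rule along a one-parameter family;
* `IsHardSphereEulerSolution.timeDerivWithin_entropyVar_eq`, `.partialDeriv_entropyVar_eq` — the
  time and space derivatives of `λ` along the solution;
* one-variable calculus of the equation of state (`hasDerivAt_logPlusG`, `hasDerivAt_zetaF`, …).
-/

noncomputable section

open Set Filter MeasureTheory Function
open scoped Topology InnerProductSpace ContDiff

namespace Summit.AtomisticToContinuum.HydrodynamicLimit.Theorems.EntropicWeakStrong

open Literature.MathematicalPhysics.KineticTheory Literature.Analysis.FunctionSpaces

/-! ### One-variable calculus of the equation of state -/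

section EOS

variable {F : ℝ → ℝ} {η₀ σ : ℝ}

/-- `y ↦ F(yσ³)` has derivative `σ³ F'(yσ³)`. -/
theorem hasDerivAt_F_comp (hFa : AnalyticOnNhd ℝ F (Ioo (-η₀) η₀)) {y : ℝ}
    (hy : y * σ ^ 3 ∈ Ioo (-η₀) η₀) :
    HasDerivAt (fun y => F (y * σ ^ 3)) (σ ^ 3 * deriv F (y * σ ^ 3)) y := by
  have h := (hFa _ hy).differentiableAt.hasDerivAt.comp y ((hasDerivAt_id y).mul_const (σ ^ 3))
  exact h.congr_deriv (by simp [mul_comm])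

/-- `y ↦ F'(yσ³)` has derivative `σ³ F''(yσ³)`. -/
theorem hasDerivAt_derivF_comp (hFa : AnalyticOnNhd ℝ F (Ioo (-η₀) η₀)) {y : ℝ}
    (hy : y * σ ^ 3 ∈ Ioo (-η₀) η₀) :
    HasDerivAt (fun y => deriv F (y * σ ^ 3)) (σ ^ 3 * deriv (deriv F) (y * σ ^ 3)) y := by
  have h := (hFa.deriv _ hy).differentiableAt.hasDerivAt.comp y
    ((hasDerivAt_id y).mul_const (σ ^ 3))
  exact h.congr_deriv (by simp [mul_comm])

/-- `y ↦ yσ³ F'(yσ³)` has derivative `σ³F'(yσ³) + yσ⁶F''(yσ³)`. -/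
theorem hasDerivAt_mul_derivF_comp (hFa : AnalyticOnNhd ℝ F (Ioo (-η₀) η₀)) {y : ℝ}
    (hy : y * σ ^ 3 ∈ Ioo (-η₀) η₀) :
    HasDerivAt (fun y => y * σ ^ 3 * deriv F (y * σ ^ 3))
      (σ ^ 3 * deriv F (y * σ ^ 3) + y * σ ^ 6 * deriv (deriv F) (y * σ ^ 3)) y := by
  have h := (((hasDerivAt_id y).mul_const (σ ^ 3))).mul (hasDerivAt_derivF_comp hFa hy)
  refine h.congr_deriv ?_
  simp only [id]
  ring

/-- The compressibility factor `ζ(y) = 1 + yσ³F'(yσ³)` as a function of the density has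
derivative `σ³F'(yσ³) + yσ⁶F''(yσ³)`. -/
theorem hasDerivAt_zetaF (hFa : AnalyticOnNhd ℝ F (Ioo (-η₀) η₀)) {y : ℝ}
    (hy : y * σ ^ 3 ∈ Ioo (-η₀) η₀) :
    HasDerivAt (fun y => 1 + y * σ ^ 3 * deriv F (y * σ ^ 3))
      (σ ^ 3 * deriv F (y * σ ^ 3) + y * σ ^ 6 * deriv (deriv F) (y * σ ^ 3)) y := by
  simpa using (hasDerivAt_mul_derivF_comp hFa hy).const_add 1

/-- `y ↦ log y + F(yσ³) + yσ³F'(yσ³)` (the density part of `λ¹`) has derivative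
`y⁻¹ + 2σ³F'(yσ³) + yσ⁶F''(yσ³) = γ/y`. -/
theorem hasDerivAt_logPlusG (hFa : AnalyticOnNhd ℝ F (Ioo (-η₀) η₀)) {y : ℝ} (hy0 : 0 < y)
    (hy : y * σ ^ 3 ∈ Ioo (-η₀) η₀) :
    HasDerivAt (fun y => Real.log y + F (y * σ ^ 3) + y * σ ^ 3 * deriv F (y * σ ^ 3))
      (y⁻¹ + 2 * σ ^ 3 * deriv F (y * σ ^ 3) + y * σ ^ 6 * deriv (deriv F) (y * σ ^ 3)) y := by
  have h := ((Real.hasDerivAt_log hy0.ne').add (hasDerivAt_F_comp hFa hy)).add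
    (hasDerivAt_mul_derivF_comp hFa hy)
  exact h.congr_deriv (by ring)

/-- The compressibility factor as a function of the density is smooth on the set of densities
whose packing lies in `(-η₀, η₀)`. -/
theorem contDiffOn_zetaF (hFa : AnalyticOnNhd ℝ F (Ioo (-η₀) η₀)) :
    ContDiffOn ℝ ∞ (fun y => 1 + y * σ ^ 3 * deriv F (y * σ ^ 3))
      {y : ℝ | y * σ ^ 3 ∈ Ioo (-η₀) η₀} := by
  have hlin : ContDiffOn ℝ ∞ (fun y : ℝ => y * σ ^ 3) {y : ℝ | y * σ ^ 3 ∈ Ioo (-η₀) η₀} :=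
    (contDiffOn_id.mul contDiffOn_const)
  have hcomp : ContDiffOn ℝ ∞ (fun y : ℝ => deriv F (y * σ ^ 3)) {y : ℝ | y * σ ^ 3 ∈ Ioo (-η₀) η₀} :=
    ((hFa.deriv.contDiffOn_of_completeSpace (n := ∞)).comp hlin fun y hy => hy)
  exact contDiffOn_const.add (hlin.mul hcomp)

/-- The set of densities whose packing lies in `(-η₀, η₀)` is open. -/
theorem isOpen_packingPreimage : IsOpen {y : ℝ | y * σ ^ 3 ∈ Ioo (-η₀) η₀} :=
  isOpen_Ioo.preimage (continuous_id.mul continuous_const)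

/-- Under the low-density equation of state, for packing `ρσ³ ∈ (0, η₀)`:
`f(ρσ³) = F(ρσ³)`, `f'(ρσ³) = F'(ρσ³)` and `hsPressure σ ρ θ = ρ θ (1 + ρσ³F'(ρσ³))`. -/
theorem eos_eqs (hF : EqOn hsExcessFreeEnergy F (Ico 0 η₀)) {ρ : ℝ} (θ : ℝ)
    (hρ : ρ * σ ^ 3 ∈ Ioo 0 η₀) :
    hsExcessFreeEnergy (ρ * σ ^ 3) = F (ρ * σ ^ 3) ∧
      deriv hsExcessFreeEnergy (ρ * σ ^ 3) = deriv F (ρ * σ ^ 3) ∧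
      hsPressure σ ρ θ = ρ * θ * (1 + ρ * σ ^ 3 * deriv F (ρ * σ ^ 3)) :=
  ⟨hF ⟨hρ.1.le, hρ.2⟩, deriv_hsExcessFreeEnergy_eq hF hρ, by
    rw [hsPressure, hsCompressibility_eq hF hρ]⟩

end EOS

/-! ### The generic chain rule for the entropy variables -/

/-- **Chain rule for the entropy variables along a one-parameter family.** If `cρ, cθ : ℝ → ℝ`
and `cu : ℝ → ℝ³` have derivatives `dρ, dθ, du` at `s₀` within `S`, `cθ s₀ ≠ 0`, and `Φ` has
derivative `Φ'` at `cρ s₀`, then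
`s ↦ (-(3/2) log cθ + Φ(cρ) + 5/2 - |cu|²/(2cθ), cθ⁻¹ cu, -cθ⁻¹)` has derivative
`(Φ' dρ - (cu·du)/cθ + (|cu|²/(2cθ²) - 3/(2cθ)) dθ, cθ⁻¹ du - (dθ/cθ²) cu, dθ/cθ²)`
at `s₀` within `S`. -/
theorem hasDerivWithinAt_entropyVar {S : Set ℝ} {s₀ : ℝ} {cρ cθ : ℝ → ℝ} {cu : ℝ → V3}
    {dρ dθ : ℝ} {du : V3} (hρ : HasDerivWithinAt cρ dρ S s₀) (hθ : HasDerivWithinAt cθ dθ S s₀)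
    (hu : HasDerivWithinAt cu du S s₀) (hθ0 : cθ s₀ ≠ 0) {Φ : ℝ → ℝ} {Φ' : ℝ}
    (hΦ : HasDerivAt Φ Φ' (cρ s₀)) :
    HasDerivWithinAt (fun s => ((-(3 / 2 * Real.log (cθ s)) + Φ (cρ s) + 5 / 2 -
        ‖cu s‖ ^ 2 / (2 * cθ s) : ℝ), (cθ s)⁻¹ • cu s, -(cθ s)⁻¹))
      ((Φ' * dρ - (∑ k, cu s₀ k * du k) / cθ s₀ +
          (‖cu s₀‖ ^ 2 / (2 * cθ s₀ ^ 2) - 3 / (2 * cθ s₀)) * dθ,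
        (cθ s₀)⁻¹ • du + (-(dθ / cθ s₀ ^ 2)) • cu s₀, dθ / cθ s₀ ^ 2)) S s₀ := by
  have hinv : HasDerivWithinAt (fun s => (cθ s)⁻¹) (-dθ / cθ s₀ ^ 2) S s₀ := by
    have h := hθ.inv hθ0
    exact h
  have hnsq : HasDerivWithinAt (fun s => ‖cu s‖ ^ 2) (2 * ∑ k, cu s₀ k * du k) S s₀ := by
    have h := hu.norm_sq
    have hinner : (⟪cu s₀, du⟫_ℝ : ℝ) = ∑ k, cu s₀ k * du k := by
      simp [PiLp.inner_apply, mul_comm]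
    rw [hinner] at h
    exact h
  -- first component
  have h1 : HasDerivWithinAt (fun s => (-(3 / 2 * Real.log (cθ s)) + Φ (cρ s) + 5 / 2 -
      ‖cu s‖ ^ 2 / (2 * cθ s) : ℝ))
      (Φ' * dρ - (∑ k, cu s₀ k * du k) / cθ s₀ +
        (‖cu s₀‖ ^ 2 / (2 * cθ s₀ ^ 2) - 3 / (2 * cθ s₀)) * dθ) S s₀ := by
    have hlog : HasDerivWithinAt (fun s => Real.log (cθ s)) (dθ / cθ s₀) S s₀ := hθ.log hθ0
    have hΦc : HasDerivWithinAt (fun s => Φ (cρ s)) (Φ' * dρ) S s₀ := hΦ.comp_hasDerivWithinAt s₀ hρ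
    have hden : HasDerivWithinAt (fun s => 2 * cθ s) (2 * dθ) S s₀ := hθ.const_mul 2
    have hquot := hnsq.div hden (mul_ne_zero two_ne_zero hθ0)
    have hall := (((hlog.const_mul (3 / 2)).neg.add hΦc).add_const (5 / 2)).sub hquot
    refine hall.congr_deriv ?_
    field_simp
    ring
  -- second component
  have h2 : HasDerivWithinAt (fun s => (cθ s)⁻¹ • cu s)
      ((cθ s₀)⁻¹ • du + (-(dθ / cθ s₀ ^ 2)) • cu s₀) S s₀ := by
    have h := hinv.smul hu
    refine h.congr_deriv ?_
    rw [neg_div]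
  -- third component
  have h3 : HasDerivWithinAt (fun s => -(cθ s)⁻¹) (dθ / cθ s₀ ^ 2) S s₀ := by
    have h := hinv.neg
    refine h.congr_deriv ?_
    rw [neg_div, neg_neg]
  exact h1.prodMk (h2.prodMk h3)

/-! ### Along a classical solution -/

section Solution

variable {σ T η₀ : ℝ} {F : ℝ → ℝ} {ρ θ : ℝ → T3 → ℝ} {u : ℝ → T3 → V3}

/-- The packing of a classical solution with `ρσ³ < η₀`, `σ > 0`, lies in `(0, η₀) ⊆ (-η₀, η₀)`. -/
theorem packing_mem (hE : IsHardSphereEulerSolution σ T ρ u θ) (hσ : 0 < σ)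
    (hpack : ∀ t ∈ Ico 0 T, ∀ x, ρ t x * σ ^ 3 < η₀) {t : ℝ} (ht : t ∈ Ico 0 T) (x : T3) :
    ρ t x * σ ^ 3 ∈ Ioo 0 η₀ ∧ ρ t x * σ ^ 3 ∈ Ioo (-η₀) η₀ := by
  have h1 : 0 < ρ t x * σ ^ 3 := mul_pos (hE.density_pos t ht x) (pow_pos hσ 3)
  have h2 := hpack t ht x
  exact ⟨⟨h1, h2⟩, ⟨by linarith, h2⟩⟩

/-- Along the solution the first entropy variable, as printed in the route statement, equals
`-(3/2) log θ + (log ρ + F(ρσ³) + ρσ³F'(ρσ³)) + 5/2 - |u|²/(2θ)`. -/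
theorem entropyVar_fst_eq (hE : IsHardSphereEulerSolution σ T ρ u θ) (hσ : 0 < σ)
    (hF : EqOn hsExcessFreeEnergy F (Ico 0 η₀)) (hpack : ∀ t ∈ Ico 0 T, ∀ x, ρ t x * σ ^ 3 < η₀)
    {t : ℝ} (ht : t ∈ Ico 0 T) (x : T3) :
    -(3 / 2 * Real.log (θ t x) - Real.log (ρ t x) - hsExcessFreeEnergy (ρ t x * σ ^ 3)) + 5 / 2 -
        ‖u t x‖ ^ 2 / (2 * θ t x) + ρ t x * σ ^ 3 * deriv hsExcessFreeEnergy (ρ t x * σ ^ 3) =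
      -(3 / 2 * Real.log (θ t x)) + (Real.log (ρ t x) + F (ρ t x * σ ^ 3) +
        ρ t x * σ ^ 3 * deriv F (ρ t x * σ ^ 3)) + 5 / 2 - ‖u t x‖ ^ 2 / (2 * θ t x) := by
  obtain ⟨e1, e2, -⟩ := eos_eqs hF (θ t x) (packing_mem hE hσ hpack ht x).1
  rw [e1, e2]
  ring

/-- **Time derivative of the entropy variables along a classical solution** (one-sided within
`[0, T)`): with `ρₜ, uₜ, θₜ` the time derivatives of the primitive fields at `(t, x)`,
`∂ₜλ = ((γ/ρ)ρₜ - (u·uₜ)/θ + (|u|²/(2θ²) - 3/(2θ))θₜ, uₜ/θ - (θₜ/θ²)u, θₜ/θ²)`,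
`γ/ρ = ρ⁻¹ + 2σ³F'(ρσ³) + ρσ⁶F''(ρσ³)`. -/
theorem timeDerivWithin_entropyVar_eq (hE : IsHardSphereEulerSolution σ T ρ u θ) (hσ : 0 < σ)
    (hFa : AnalyticOnNhd ℝ F (Ioo (-η₀) η₀)) (hF : EqOn hsExcessFreeEnergy F (Ico 0 η₀))
    (hpack : ∀ t ∈ Ico 0 T, ∀ x, ρ t x * σ ^ 3 < η₀) {t : ℝ} (ht : t ∈ Ico 0 T) (x : T3) :
    Torus.timeDerivWithin (Ico 0 T) (fun s y => ((-(3 / 2 * Real.log (θ s y) - Real.log (ρ s y) -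
        hsExcessFreeEnergy (ρ s y * σ ^ 3)) + 5 / 2 - ‖u s y‖ ^ 2 / (2 * θ s y) +
        ρ s y * σ ^ 3 * deriv hsExcessFreeEnergy (ρ s y * σ ^ 3) : ℝ),
        (θ s y)⁻¹ • u s y, -(θ s y)⁻¹)) t x =
      (((ρ t x)⁻¹ + 2 * σ ^ 3 * deriv F (ρ t x * σ ^ 3) +
            ρ t x * σ ^ 6 * deriv (deriv F) (ρ t x * σ ^ 3)) *
          Torus.timeDerivWithin (Ico 0 T) ρ t x -
          (∑ k, u t x k * Torus.timeDerivWithin (Ico 0 T) u t x k) / θ t x +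
          (‖u t x‖ ^ 2 / (2 * θ t x ^ 2) - 3 / (2 * θ t x)) * Torus.timeDerivWithin (Ico 0 T) θ t x,
        (θ t x)⁻¹ • Torus.timeDerivWithin (Ico 0 T) u t x +
          (-(Torus.timeDerivWithin (Ico 0 T) θ t x / θ t x ^ 2)) • u t x,
        Torus.timeDerivWithin (Ico 0 T) θ t x / θ t x ^ 2) := by
  have hU : UniqueDiffOn ℝ (Ico (0 : ℝ) T) := uniqueDiffOn_Ico 0 T
  obtain ⟨hη, hη'⟩ := packing_mem hE hσ hpack ht x
  have hderiv := hasDerivWithinAt_entropyVar (hE.smooth_density.hasDerivWithinAt_slice ht x)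
    (hE.smooth_temperature.hasDerivWithinAt_slice ht x)
    (hE.smooth_velocity.hasDerivWithinAt_slice ht x) (hE.temperature_pos t ht x).ne'
    (hasDerivAt_logPlusG hFa (hE.density_pos t ht x) hη')
  -- the printed field agrees with the normal form on `[0, T)`
  unfold Torus.timeDerivWithin
  refine (hderiv.congr (fun s hs => ?_) ?_).derivWithin (hU t ht)
  · simp only [entropyVar_fst_eq hE hσ hF hpack hs x]
  · simp only [entropyVar_fst_eq hE hσ hF hpack ht x]

/-- **Space derivatives of the entropy variables along a classical solution**: with
`ρᵢ, uᵢ, θᵢ` the `i`-th partial derivatives of the primitive fields at `(t, x)`,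
`∂ᵢλ = ((γ/ρ)ρᵢ - (u·uᵢ)/θ + (|u|²/(2θ²) - 3/(2θ))θᵢ, uᵢ/θ - (θᵢ/θ²)u, θᵢ/θ²)`. -/
theorem partialDeriv_entropyVar_eq (hE : IsHardSphereEulerSolution σ T ρ u θ) (hσ : 0 < σ)
    (hFa : AnalyticOnNhd ℝ F (Ioo (-η₀) η₀)) (hF : EqOn hsExcessFreeEnergy F (Ico 0 η₀))
    (hpack : ∀ t ∈ Ico 0 T, ∀ x, ρ t x * σ ^ 3 < η₀) {t : ℝ} (ht : t ∈ Ico 0 T) (x : T3)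
    (i : Fin 3) :
    Torus.partialDeriv i (fun y => ((-(3 / 2 * Real.log (θ t y) - Real.log (ρ t y) -
        hsExcessFreeEnergy (ρ t y * σ ^ 3)) + 5 / 2 - ‖u t y‖ ^ 2 / (2 * θ t y) +
        ρ t y * σ ^ 3 * deriv hsExcessFreeEnergy (ρ t y * σ ^ 3) : ℝ),
        (θ t y)⁻¹ • u t y, -(θ t y)⁻¹)) x =
      (((ρ t x)⁻¹ + 2 * σ ^ 3 * deriv F (ρ t x * σ ^ 3) +
            ρ t x * σ ^ 6 * deriv (deriv F) (ρ t x * σ ^ 3)) * Torus.partialDeriv i (ρ t) x -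
          (∑ k, u t x k * Torus.partialDeriv i (u t) x k) / θ t x +
          (‖u t x‖ ^ 2 / (2 * θ t x ^ 2) - 3 / (2 * θ t x)) * Torus.partialDeriv i (θ t) x,
        (θ t x)⁻¹ • Torus.partialDeriv i (u t) x +
          (-(Torus.partialDeriv i (θ t) x / θ t x ^ 2)) • u t x,
        Torus.partialDeriv i (θ t) x / θ t x ^ 2) := by
  obtain ⟨hη, hη'⟩ := packing_mem hE hσ hpack ht x
  have hρ1 : Torus.IsContDiff 1 (ρ t) := (hE.smooth_density.isSmooth_slice ht).isContDiff (by simp)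
  have hθ1 : Torus.IsContDiff 1 (θ t) :=
    (hE.smooth_temperature.isSmooth_slice ht).isContDiff (by simp)
  have hu1 : Torus.IsContDiff 1 (u t) := (hE.smooth_velocity.isSmooth_slice ht).isContDiff (by simp)
  have cρ := HsEulerCalc.hasDerivAt_coordLine hρ1 x i
  have cθ := HsEulerCalc.hasDerivAt_coordLine hθ1 x i
  have cu : HasDerivAt (fun s : ℝ => u t (x + Torus.proj (s • EuclideanSpace.single i (1 : ℝ))))
      (Torus.partialDeriv i (u t) x) 0 := by
    have h := Torus.hasDerivAt_comp_add_proj_smul hu1 x (EuclideanSpace.single i (1 : ℝ)) 0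
    simp only [zero_smul, Torus.proj_zero, add_zero] at h
    exact h
  have hθx : θ t (x + Torus.proj ((0 : ℝ) • EuclideanSpace.single i (1 : ℝ))) ≠ 0 := by
    simp only [zero_smul, Torus.proj_zero, add_zero]
    exact (hE.temperature_pos t ht x).ne'
  have hΦ : HasDerivAt (fun y => Real.log y + F (y * σ ^ 3) + y * σ ^ 3 * deriv F (y * σ ^ 3))
      ((ρ t x)⁻¹ + 2 * σ ^ 3 * deriv F (ρ t x * σ ^ 3) +
        ρ t x * σ ^ 6 * deriv (deriv F) (ρ t x * σ ^ 3))
      (ρ t (x + Torus.proj ((0 : ℝ) • EuclideanSpace.single i (1 : ℝ)))) := by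
    simp only [zero_smul, Torus.proj_zero, add_zero]
    exact hasDerivAt_logPlusG hFa (hE.density_pos t ht x) hη'
  have hderiv := hasDerivWithinAt_entropyVar cρ.hasDerivWithinAt cθ.hasDerivWithinAt
    cu.hasDerivWithinAt hθx hΦ (S := univ)
  simp only [zero_smul, Torus.proj_zero, add_zero] at hderiv
  unfold Torus.partialDeriv Torus.lineDeriv
  refine ((hderiv.congr (fun s _ => ?_) ?_).hasDerivAt Filter.univ_mem).deriv
  · simp only [entropyVar_fst_eq hE hσ hF hpack ht]
  · simp only [entropyVar_fst_eq hE hσ hF hpack ht]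

end Solution

end Summit.AtomisticToContinuum.HydrodynamicLimit.Theorems.EntropicWeakStrong

end
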